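import Mathlib
import Summits.Ventures.PercRepro2.CoinChainXAMGateChain
import Summits.Ventures.PercRepro2.CoinChainXAMMinusGeneral

/-!
# EVERY M-supported gate of the chain — the unconditional chain theorem
(blind cell PercRepro2, night-2 g32; proofs/NIGHT2-DARC.md §73.6k)

`chain_XA'_mgate`: for `ent = {m}`, ANY `ent' ∋ j, j'`, the entry markers and ANY gate `d'` vanishing off the
sure-entered clusters (`m ∉ W → d' W = 0`; `d'` log-supermodular, `d' ≤ d`, `(d, d')` cross-log-supermodular), with
positive `d`-masses on the four marker cells of the sure-entered clusters, the cleared (XA′) holds — with NO further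
hypothesis: `chain_XA'_mgate_of_mminus` reduces the gate to the sixth-corner inequality (M⁻) in the eleven region
sums, and `cg_mminus_general` (the 1,711-term Handelman certificate of kit j328631 over the thirteen marker cells,
assembled in `cg_mminus_cells`) proves (M⁻) from the chain's own Ahlswede–Daykin facts `JU`, `JM`, `McM`, `McM_xy`,
`(B, B)`, `(B, B)_xy`, `MM`.  The only work here is bookkeeping: each region sum is the sum of its four marker
cells (`δ = K₀ + K₁ + K₂ + K₁₂`, `XJ = K₁ + K₁₂`, …), the facts are rewritten into the cells, and the target is
literally the conclusion of `cg_mminus_general`.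
-/

namespace Summit.Ventures.PercRepro2.Coin

open Classical

section MGateAll

variable {V : Type*} [DecidableEq V] {R : Type*} [Field R] [LinearOrder R] [IsStrictOrderedRing R]

set_option maxHeartbeats 4000000 in
/-- **THE M-GATE OF THE CHAIN, UNCONDITIONAL**: for `ent = {m}`, any `ent' ∋ j, j'`, the entry markers and any gate
vanishing off the `m`-clusters, with positive `d`-masses on the four cells of the `m`-clusters, the cleared (XA′) holds. -/
theorem chain_XA'_mgate (U : Finset V) (m j j' : V) (ent' : Finset V) (ν c d d' : Finset V → R)
    (hj : j ∈ ent') (hj' : j' ∈ ent')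
    (hν0 : ∀ W, 0 ≤ ν W) (hν : ∀ s ⊆ U, ∀ t ⊆ U, ν s * ν t ≤ ν (s ∩ t) * ν (s ∪ t))
    (hc0 : ∀ W, 0 ≤ c W) (hd0 : ∀ W, 0 ≤ d W) (hdc : ∀ W, d W ≤ c W)
    (hcd : ∀ s t, c s * d t ≤ c (s ∩ t) * d (s ∪ t))
    (hratio : ∀ s t, s ⊆ t → d s * c t ≤ c s * d t)
    (hdd : ∀ s t, d s * d t ≤ d (s ∩ t) * d (s ∪ t))
    (hd'0 : ∀ W, 0 ≤ d' W) (hd'd : ∀ W, d' W ≤ d W)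
    (hd'd' : ∀ s t, d' s * d' t ≤ d' (s ∩ t) * d' (s ∪ t))
    (hdd' : ∀ s t, d s * d' t ≤ d (s ∩ t) * d' (s ∪ t))
    (hD : ∀ W, m ∉ W → d' W = 0)
    (x y : Finset V → R) (hx : ∀ W, x W = if j ∈ W then 1 else 0) (hy : ∀ W, y W = if j' ∈ W then 1 else 0)
    (hbpos : 0 < ∑ W ∈ U.powerset.filter (fun W => ∃ r ∈ ({m} : Finset V), r ∈ W), ν W * d W * ((1 - x W) * (1 - y W)))
    (hb1pos : 0 < ∑ W ∈ U.powerset.filter (fun W => ∃ r ∈ ({m} : Finset V), r ∈ W), ν W * d W * (x W * (1 - y W)))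
    (hb2pos : 0 < ∑ W ∈ U.powerset.filter (fun W => ∃ r ∈ ({m} : Finset V), r ∈ W), ν W * d W * ((1 - x W) * y W))
    (hb12pos : 0 < ∑ W ∈ U.powerset.filter (fun W => ∃ r ∈ ({m} : Finset V), r ∈ W), ν W * d W * (x W * y W)) :
    (((∑ W ∈ U.powerset, ν W * chainMix {m} ent' 0 c d W) * (∑ W ∈ U.powerset, ν W * chainMix {m} ent' 1 c d W * x W) - (∑ W ∈ U.powerset, ν W * chainMix {m} ent' 0 c d W * x W) * (∑ W ∈ U.powerset, ν W * chainMix {m} ent' 1 c d W)) *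
          ((∑ W ∈ U.powerset, ν W * chainMix {m} ent' 0 c d W) * (∑ W ∈ U.powerset, ν W * chainMix {m} ent' 0 c d' W * y W) - (∑ W ∈ U.powerset, ν W * chainMix {m} ent' 0 c d W * y W) * (∑ W ∈ U.powerset, ν W * chainMix {m} ent' 0 c d' W))
        + ((∑ W ∈ U.powerset, ν W * chainMix {m} ent' 0 c d W) * (∑ W ∈ U.powerset, ν W * chainMix {m} ent' 1 c d W * y W) - (∑ W ∈ U.powerset, ν W * chainMix {m} ent' 0 c d W * y W) * (∑ W ∈ U.powerset, ν W * chainMix {m} ent' 1 c d W)) *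
          ((∑ W ∈ U.powerset, ν W * chainMix {m} ent' 0 c d W) * (∑ W ∈ U.powerset, ν W * chainMix {m} ent' 0 c d' W * x W) - (∑ W ∈ U.powerset, ν W * chainMix {m} ent' 0 c d W * x W) * (∑ W ∈ U.powerset, ν W * chainMix {m} ent' 0 c d' W))) ≤
        (∑ W ∈ U.powerset, ν W * chainMix {m} ent' 0 c d W) * ((∑ W ∈ U.powerset, ν W * chainMix {m} ent' 0 c d W) * (∑ W ∈ U.powerset, ν W * chainMix {m} ent' 0 c d W) * (∑ W ∈ U.powerset, ν W * chainMix {m} ent' 1 c d' W * (x W * y W))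
          - (∑ W ∈ U.powerset, ν W * chainMix {m} ent' 0 c d W) * (∑ W ∈ U.powerset, ν W * chainMix {m} ent' 0 c d W * y W) * (∑ W ∈ U.powerset, ν W * chainMix {m} ent' 1 c d' W * x W)
          - (∑ W ∈ U.powerset, ν W * chainMix {m} ent' 0 c d W) * (∑ W ∈ U.powerset, ν W * chainMix {m} ent' 0 c d W * x W) * (∑ W ∈ U.powerset, ν W * chainMix {m} ent' 1 c d' W * y W)
          + (∑ W ∈ U.powerset, ν W * chainMix {m} ent' 0 c d W * x W) * (∑ W ∈ U.powerset, ν W * chainMix {m} ent' 0 c d W * y W) * (∑ W ∈ U.powerset, ν W * chainMix {m} ent' 1 c d' W))  := by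
  refine chain_XA'_mgate_of_mminus U m j j' ent' ν c d d' hj hj' hν0 hν hc0 hd0 hdc hcd hratio hdd hd'0 hd'd hd'd' hdd' hD
    x y hx hy hbpos hb1pos hb2pos hb12pos ?_
  have hx0 : ∀ W, 0 ≤ x W := fun W => by rw [hx W]; split_ifs <;> norm_num
  have hy0 : ∀ W, 0 ≤ y W := fun W => by rw [hy W]; split_ifs <;> norm_num
  have hx1 : ∀ W, x W ≤ 1 := fun W => by rw [hx W]; split_ifs <;> norm_num
  have hy1 : ∀ W, y W ≤ 1 := fun W => by rw [hy W]; split_ifs <;> norm_num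
  have hxm : ∀ s t, x s ≤ x (s ∪ t) := fun s t => by
    rw [hx s, hx (s ∪ t)]
    by_cases h : j ∈ s
    · rw [if_pos h, if_pos (Finset.mem_union_left t h)]
    · rw [if_neg h]; split_ifs <;> norm_num
  have hym : ∀ s t, y s ≤ y (s ∪ t) := fun s t => by
    rw [hy s, hy (s ∪ t)]
    by_cases h : j' ∈ s
    · rw [if_pos h, if_pos (Finset.mem_union_left t h)]
    · rw [if_neg h]; split_ifs <;> norm_num
  have hxI : ∀ W, (¬ ∃ r ∈ ({m} : Finset V) ∪ ent', r ∈ W) → x W = 0 := fun W hW => by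
    rw [hx W]; exact if_neg (fun h => hW ⟨j, Finset.mem_union.2 (Or.inr hj), h⟩)
  have hyI : ∀ W, (¬ ∃ r ∈ ({m} : Finset V) ∪ ent', r ∈ W) → y W = 0 := fun W hW => by
    rw [hy W]; exact if_neg (fun h => hW ⟨j', Finset.mem_union.2 (Or.inr hj'), h⟩)
  -- the part sums
  set a := (∑ W ∈ U.powerset.filter (fun W => ¬ ∃ r ∈ ({m} : Finset V) ∪ ent', r ∈ W), ν W * c W) with ha_def
  set δ := (∑ W ∈ U.powerset.filter (fun W => (¬ ∃ r ∈ ({m} : Finset V), r ∈ W) ∧ ∃ r ∈ ent', r ∈ W), ν W * (c W - d W)) with hδ_def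
  set u := (∑ W ∈ U.powerset.filter (fun W => (¬ ∃ r ∈ ({m} : Finset V), r ∈ W) ∧ ∃ r ∈ ent', r ∈ W), ν W * d W) with hu_def
  set t := (∑ W ∈ U.powerset.filter (fun W => ∃ r ∈ ({m} : Finset V), r ∈ W), ν W * d W) with ht_def
  set XJ := (∑ W ∈ U.powerset.filter (fun W => (¬ ∃ r ∈ ({m} : Finset V), r ∈ W) ∧ ∃ r ∈ ent', r ∈ W), ν W * (c W - d W) * x W) with hXJ_def
  set XU := (∑ W ∈ U.powerset.filter (fun W => (¬ ∃ r ∈ ({m} : Finset V), r ∈ W) ∧ ∃ r ∈ ent', r ∈ W), ν W * d W * x W) with hXU_def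
  set XM := (∑ W ∈ U.powerset.filter (fun W => ∃ r ∈ ({m} : Finset V), r ∈ W), ν W * d W * x W) with hXM_def
  set YJ := (∑ W ∈ U.powerset.filter (fun W => (¬ ∃ r ∈ ({m} : Finset V), r ∈ W) ∧ ∃ r ∈ ent', r ∈ W), ν W * (c W - d W) * y W) with hYJ_def
  set YU := (∑ W ∈ U.powerset.filter (fun W => (¬ ∃ r ∈ ({m} : Finset V), r ∈ W) ∧ ∃ r ∈ ent', r ∈ W), ν W * d W * y W) with hYU_def
  set YM := (∑ W ∈ U.powerset.filter (fun W => ∃ r ∈ ({m} : Finset V), r ∈ W), ν W * d W * y W) with hYM_def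
  set XYM := (∑ W ∈ U.powerset.filter (fun W => ∃ r ∈ ({m} : Finset V), r ∈ W), ν W * d W * (x W * y W)) with hXYM_def
  have hcd0 : ∀ W, 0 ≤ c W - d W := fun W => by linarith [hdc W]
  have ha : 0 ≤ a := Finset.sum_nonneg (fun W _ => mul_nonneg (hν0 W) (hc0 W))
  have hδ : 0 ≤ δ := Finset.sum_nonneg (fun W _ => mul_nonneg (hν0 W) (hcd0 W))
  have hu : 0 ≤ u := Finset.sum_nonneg (fun W _ => mul_nonneg (hν0 W) (hd0 W))
  have ht : 0 ≤ t := Finset.sum_nonneg (fun W _ => mul_nonneg (hν0 W) (hd0 W))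
  have hXJ : 0 ≤ XJ := Finset.sum_nonneg (fun W _ => mul_nonneg (mul_nonneg (hν0 W) (hcd0 W)) (hx0 W))
  have hXU : 0 ≤ XU := Finset.sum_nonneg (fun W _ => mul_nonneg (mul_nonneg (hν0 W) (hd0 W)) (hx0 W))
  have hXM : 0 ≤ XM := Finset.sum_nonneg (fun W _ => mul_nonneg (mul_nonneg (hν0 W) (hd0 W)) (hx0 W))
  have hYJ : 0 ≤ YJ := Finset.sum_nonneg (fun W _ => mul_nonneg (mul_nonneg (hν0 W) (hcd0 W)) (hy0 W))
  have hYU : 0 ≤ YU := Finset.sum_nonneg (fun W _ => mul_nonneg (mul_nonneg (hν0 W) (hd0 W)) (hy0 W))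
  have hYM : 0 ≤ YM := Finset.sum_nonneg (fun W _ => mul_nonneg (mul_nonneg (hν0 W) (hd0 W)) (hy0 W))
  have hXYM : 0 ≤ XYM := Finset.sum_nonneg (fun W _ => mul_nonneg (mul_nonneg (hν0 W) (hd0 W)) (mul_nonneg (hx0 W) (hy0 W)))
  have hXJδ : XJ ≤ δ := Finset.sum_le_sum (fun W _ => mul_le_of_le_one_right (mul_nonneg (hν0 W) (hcd0 W)) (hx1 W))
  have hYJδ : YJ ≤ δ := Finset.sum_le_sum (fun W _ => mul_le_of_le_one_right (mul_nonneg (hν0 W) (hcd0 W)) (hy1 W))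
  have hXUu : XU ≤ u := Finset.sum_le_sum (fun W _ => mul_le_of_le_one_right (mul_nonneg (hν0 W) (hd0 W)) (hx1 W))
  have hYUu : YU ≤ u := Finset.sum_le_sum (fun W _ => mul_le_of_le_one_right (mul_nonneg (hν0 W) (hd0 W)) (hy1 W))
  have hXMt : XM ≤ t := Finset.sum_le_sum (fun W _ => mul_le_of_le_one_right (mul_nonneg (hν0 W) (hd0 W)) (hx1 W))
  have hYMt : YM ≤ t := Finset.sum_le_sum (fun W _ => mul_le_of_le_one_right (mul_nonneg (hν0 W) (hd0 W)) (hy1 W))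
  have hXYMx : XYM ≤ XM := Finset.sum_le_sum (fun W _ => by
    calc ν W * d W * (x W * y W) = (ν W * d W * x W) * y W := by ring
      _ ≤ ν W * d W * x W := mul_le_of_le_one_right (mul_nonneg (mul_nonneg (hν0 W) (hd0 W)) (hx0 W)) (hy1 W))
  have hXYMy : XYM ≤ YM := Finset.sum_le_sum (fun W _ => by
    calc ν W * d W * (x W * y W) = (ν W * d W * y W) * x W := by ring
      _ ≤ ν W * d W * y W := mul_le_of_le_one_right (mul_nonneg (mul_nonneg (hν0 W) (hd0 W)) (hy0 W)) (hx1 W))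
  -- the ideal carries no marker
  have hIx : (∑ W ∈ U.powerset.filter (fun W => ¬ ∃ r ∈ ({m} : Finset V) ∪ ent', r ∈ W), ν W * c W * x W) = 0 :=
    cgate_sum_zero U _ _ (fun W hW => by rw [hxI W hW, mul_zero])
  have hIy : (∑ W ∈ U.powerset.filter (fun W => ¬ ∃ r ∈ ({m} : Finset V) ∪ ent', r ∈ W), ν W * c W * y W) = 0 :=
    cgate_sum_zero U _ _ (fun W hW => by rw [hyI W hW, mul_zero])
  -- the Holley facts of the five corners
  have FJUx := cg_fact_JU' U {m} ent' ν c d hν0 hν hc0 hd0 hdc hcd hratio x hx0 hxm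
  have FJMx := cg_fact_JM' U {m} ent' ν c d hν0 hν hc0 hd0 hdc hcd hratio x hx0 hxm
  have FJUy := cg_fact_JU' U {m} ent' ν c d hν0 hν hc0 hd0 hdc hcd hratio y hy0 hym
  have FJMy := cg_fact_JM' U {m} ent' ν c d hν0 hν hc0 hd0 hdc hcd hratio y hy0 hym
  rw [cg_entfree_piecewise U {m} ent' ν c d x, cg_entfree_piecewise' U {m} ent' ν c d, hIx, zero_add] at FJUx FJMx
  rw [cg_entfree_piecewise U {m} ent' ν c d y, cg_entfree_piecewise' U {m} ent' ν c d, hIy, zero_add] at FJUy FJMy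
  have FMx := cg_fact_McM U {m} ent' ν c d hν0 hν hc0 hd0 hcd x hx0 hxm
  have FMy := cg_fact_McM U {m} ent' ν c d hν0 hν hc0 hd0 hcd y hy0 hym
  have FM2 := cg_fact_McM2 U {m} ent' ν c d hν0 hν hc0 hd0 hcd x y hx0 hy0 hxm hym
  have FM2' := cg_fact_McM2 U {m} ent' ν c d hν0 hν hc0 hd0 hcd y x hy0 hx0 hym hxm
  rw [sum_entfree_split U {m} ent' (fun W => ν W * c W), cg_split' U ν c d (fun W => (¬ ∃ r ∈ ({m} : Finset V), r ∈ W) ∧ ∃ r ∈ ent', r ∈ W), cg_split U ν c d (fun W => (¬ ∃ r ∈ ({m} : Finset V), r ∈ W) ∧ ∃ r ∈ ent', r ∈ W) x] at FMx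
  rw [sum_entfree_split U {m} ent' (fun W => ν W * c W), cg_split' U ν c d (fun W => (¬ ∃ r ∈ ({m} : Finset V), r ∈ W) ∧ ∃ r ∈ ent', r ∈ W), cg_split U ν c d (fun W => (¬ ∃ r ∈ ({m} : Finset V), r ∈ W) ∧ ∃ r ∈ ent', r ∈ W) y] at FMy
  rw [sum_entfree_split U {m} ent' (fun W => ν W * c W), cg_split' U ν c d (fun W => (¬ ∃ r ∈ ({m} : Finset V), r ∈ W) ∧ ∃ r ∈ ent', r ∈ W), cg_split U ν c d (fun W => (¬ ∃ r ∈ ({m} : Finset V), r ∈ W) ∧ ∃ r ∈ ent', r ∈ W) y] at FM2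
  rw [sum_entfree_split U {m} ent' (fun W => ν W * c W), cg_split' U ν c d (fun W => (¬ ∃ r ∈ ({m} : Finset V), r ∈ W) ∧ ∃ r ∈ ent', r ∈ W), cg_split U ν c d (fun W => (¬ ∃ r ∈ ({m} : Finset V), r ∈ W) ∧ ∃ r ∈ ent', r ∈ W) x] at FM2'
  have eyx : ∑ W ∈ U.powerset.filter (fun W => ∃ r ∈ ({m} : Finset V), r ∈ W), ν W * d W * (y W * x W) = XYM :=
    Finset.sum_congr rfl (fun W _ => by ring)
  rw [eyx] at FM2'
  -- the surviving-vs-sure-entered facts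
  have FBx := cg_fact_BB U {m} ent' ν d hν0 hν hd0 hdd x hx0 hxm
  have FBy := cg_fact_BB U {m} ent' ν d hν0 hν hd0 hdd y hy0 hym
  have FB2 := cg_fact_BB2 U {m} ent' ν d hν0 hν hd0 hdd y x hy0 hx0 hym hxm
  have FB2' := cg_fact_BB2 U {m} ent' ν d hν0 hν hd0 hdd x y hx0 hy0 hxm hym
  rw [sum_entfree_split U {m} ent' (fun W => ν W * d W)] at FBx FBy FB2 FB2'
  rw [eyx] at FB2
  have hBI : (∑ W ∈ U.powerset.filter (fun W => ¬ ∃ r ∈ ({m} : Finset V) ∪ ent', r ∈ W), ν W * d W) ≤ a :=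
    Finset.sum_le_sum (fun W _ => mul_le_mul_of_nonneg_left (hdc W) (hν0 W))
  have hBx : 0 ≤ XM * (a + u) - XU * t := by
    have h := mul_le_mul_of_nonneg_right hBI hXM
    linarith only [FBx, h]
  have hBy : 0 ≤ YM * (a + u) - YU * t := by
    have h := mul_le_mul_of_nonneg_right hBI hYM
    linarith only [FBy, h]
  have hBB2 : 0 ≤ XYM * (a + u) - YU * XM := by
    have h := mul_le_mul_of_nonneg_right hBI hXYM
    linarith only [FB2, h]
  have hBB2' : 0 ≤ XYM * (a + u) - XU * YM := by
    have h := mul_le_mul_of_nonneg_right hBI hXYM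
    linarith only [FB2', h]
  have FMM := cg_fact_MM U ν d hν0 hν hd0 hdd m x y hx0 hy0 hxm hym
  -- the thirteen facts of (M⁻) in the parts
  have hJUx : 0 ≤ XU * (a + δ) - XJ * u := by linear_combination FJUx
  have hJMx : 0 ≤ XM * (a + δ) - XJ * t := by linear_combination FJMx
  have hMcMx : 0 ≤ XM * (a + δ + u) - (XJ + XU) * t := by linear_combination FMx
  have hJUy : 0 ≤ YU * (a + δ) - YJ * u := by linear_combination FJUy
  have hJMy : 0 ≤ YM * (a + δ) - YJ * t := by linear_combination FJMy
  have hMcMy : 0 ≤ YM * (a + δ + u) - (YJ + YU) * t := by linear_combination FMy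
  have hMcM2 : 0 ≤ XYM * (a + δ + u) - (YJ + YU) * XM := by linear_combination FM2
  have hMcM2' : 0 ≤ XYM * (a + δ + u) - (XJ + XU) * YM := by linear_combination FM2'
  have hMM : 0 ≤ XYM * t - XM * YM := by linear_combination FMM
  clear FJUx FJMx FMx FJUy FJMy FMy FM2 FM2' FMM FBx FBy FB2 FB2' hBI
  -- the cells
  set K0 := (∑ W ∈ U.powerset.filter (fun W => (¬ ∃ r ∈ ({m} : Finset V), r ∈ W) ∧ ∃ r ∈ ent', r ∈ W), ν W * (c W - d W) * ((1 - x W) * (1 - y W))) with hK0_def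
  set K1 := (∑ W ∈ U.powerset.filter (fun W => (¬ ∃ r ∈ ({m} : Finset V), r ∈ W) ∧ ∃ r ∈ ent', r ∈ W), ν W * (c W - d W) * (x W * (1 - y W))) with hK1_def
  set K2 := (∑ W ∈ U.powerset.filter (fun W => (¬ ∃ r ∈ ({m} : Finset V), r ∈ W) ∧ ∃ r ∈ ent', r ∈ W), ν W * (c W - d W) * ((1 - x W) * y W)) with hK2_def
  set K12 := (∑ W ∈ U.powerset.filter (fun W => (¬ ∃ r ∈ ({m} : Finset V), r ∈ W) ∧ ∃ r ∈ ent', r ∈ W), ν W * (c W - d W) * (x W * y W)) with hK12_def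
  set u0 := (∑ W ∈ U.powerset.filter (fun W => (¬ ∃ r ∈ ({m} : Finset V), r ∈ W) ∧ ∃ r ∈ ent', r ∈ W), ν W * d W * ((1 - x W) * (1 - y W))) with hu0_def
  set U1 := (∑ W ∈ U.powerset.filter (fun W => (¬ ∃ r ∈ ({m} : Finset V), r ∈ W) ∧ ∃ r ∈ ent', r ∈ W), ν W * d W * (x W * (1 - y W))) with hU1_def
  set U2 := (∑ W ∈ U.powerset.filter (fun W => (¬ ∃ r ∈ ({m} : Finset V), r ∈ W) ∧ ∃ r ∈ ent', r ∈ W), ν W * d W * ((1 - x W) * y W)) with hU2_def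
  set U12 := (∑ W ∈ U.powerset.filter (fun W => (¬ ∃ r ∈ ({m} : Finset V), r ∈ W) ∧ ∃ r ∈ ent', r ∈ W), ν W * d W * (x W * y W)) with hU12_def
  set b := (∑ W ∈ U.powerset.filter (fun W => ∃ r ∈ ({m} : Finset V), r ∈ W), ν W * d W * ((1 - x W) * (1 - y W))) with hb_def
  set b1 := (∑ W ∈ U.powerset.filter (fun W => ∃ r ∈ ({m} : Finset V), r ∈ W), ν W * d W * (x W * (1 - y W))) with hb1_def
  set b2 := (∑ W ∈ U.powerset.filter (fun W => ∃ r ∈ ({m} : Finset V), r ∈ W), ν W * d W * ((1 - x W) * y W)) with hb2_def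
  have hK00 : 0 ≤ K0 := Finset.sum_nonneg (fun W _ => mul_nonneg (mul_nonneg (hν0 W) (hcd0 W)) (mul_nonneg (sub_nonneg.2 (hx1 W)) (sub_nonneg.2 (hy1 W))))
  have hK10 : 0 ≤ K1 := Finset.sum_nonneg (fun W _ => mul_nonneg (mul_nonneg (hν0 W) (hcd0 W)) (mul_nonneg (hx0 W) (sub_nonneg.2 (hy1 W))))
  have hK20 : 0 ≤ K2 := Finset.sum_nonneg (fun W _ => mul_nonneg (mul_nonneg (hν0 W) (hcd0 W)) (mul_nonneg (sub_nonneg.2 (hx1 W)) (hy0 W)))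
  have hK120 : 0 ≤ K12 := Finset.sum_nonneg (fun W _ => mul_nonneg (mul_nonneg (hν0 W) (hcd0 W)) (mul_nonneg (hx0 W) (hy0 W)))
  have hu00 : 0 ≤ u0 := Finset.sum_nonneg (fun W _ => mul_nonneg (mul_nonneg (hν0 W) (hd0 W)) (mul_nonneg (sub_nonneg.2 (hx1 W)) (sub_nonneg.2 (hy1 W))))
  have hU10 : 0 ≤ U1 := Finset.sum_nonneg (fun W _ => mul_nonneg (mul_nonneg (hν0 W) (hd0 W)) (mul_nonneg (hx0 W) (sub_nonneg.2 (hy1 W))))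
  have hU20 : 0 ≤ U2 := Finset.sum_nonneg (fun W _ => mul_nonneg (mul_nonneg (hν0 W) (hd0 W)) (mul_nonneg (sub_nonneg.2 (hx1 W)) (hy0 W)))
  have hU120 : 0 ≤ U12 := Finset.sum_nonneg (fun W _ => mul_nonneg (mul_nonneg (hν0 W) (hd0 W)) (mul_nonneg (hx0 W) (hy0 W)))
  have hb0 : 0 ≤ b := Finset.sum_nonneg (fun W _ => mul_nonneg (mul_nonneg (hν0 W) (hd0 W)) (mul_nonneg (sub_nonneg.2 (hx1 W)) (sub_nonneg.2 (hy1 W))))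
  have hb10 : 0 ≤ b1 := Finset.sum_nonneg (fun W _ => mul_nonneg (mul_nonneg (hν0 W) (hd0 W)) (mul_nonneg (hx0 W) (sub_nonneg.2 (hy1 W))))
  have hb20 : 0 ≤ b2 := Finset.sum_nonneg (fun W _ => mul_nonneg (mul_nonneg (hν0 W) (hd0 W)) (mul_nonneg (sub_nonneg.2 (hx1 W)) (hy0 W)))
  have eδ : δ = K0 + K1 + K2 + K12 := by
    rw [hδ_def, hK0_def, hK1_def, hK2_def, hK12_def, ← Finset.sum_add_distrib, ← Finset.sum_add_distrib, ← Finset.sum_add_distrib]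
    exact Finset.sum_congr rfl (fun W _ => by ring)
  have eu : u = u0 + U1 + U2 + U12 := by
    rw [hu_def, hu0_def, hU1_def, hU2_def, hU12_def, ← Finset.sum_add_distrib, ← Finset.sum_add_distrib, ← Finset.sum_add_distrib]
    exact Finset.sum_congr rfl (fun W _ => by ring)
  have et : t = b + b1 + b2 + XYM := by
    rw [ht_def, hb_def, hb1_def, hb2_def, hXYM_def, ← Finset.sum_add_distrib, ← Finset.sum_add_distrib, ← Finset.sum_add_distrib]
    exact Finset.sum_congr rfl (fun W _ => by ring)
  have eXJ : XJ = K1 + K12 := by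
    rw [hXJ_def, hK1_def, hK12_def, ← Finset.sum_add_distrib]
    exact Finset.sum_congr rfl (fun W _ => by ring)
  have eXU : XU = U1 + U12 := by
    rw [hXU_def, hU1_def, hU12_def, ← Finset.sum_add_distrib]
    exact Finset.sum_congr rfl (fun W _ => by ring)
  have eXM : XM = b1 + XYM := by
    rw [hXM_def, hb1_def, hXYM_def, ← Finset.sum_add_distrib]
    exact Finset.sum_congr rfl (fun W _ => by ring)
  have eYJ : YJ = K2 + K12 := by
    rw [hYJ_def, hK2_def, hK12_def, ← Finset.sum_add_distrib]
    exact Finset.sum_congr rfl (fun W _ => by ring)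
  have eYU : YU = U2 + U12 := by
    rw [hYU_def, hU2_def, hU12_def, ← Finset.sum_add_distrib]
    exact Finset.sum_congr rfl (fun W _ => by ring)
  have eYM : YM = b2 + XYM := by
    rw [hYM_def, hb2_def, hXYM_def, ← Finset.sum_add_distrib]
    exact Finset.sum_congr rfl (fun W _ => by ring)
  -- the facts and the target in the cells
  rw [eXU, eδ, eXJ, eu] at hJUx
  rw [eXM, eδ, eXJ, et] at hJMx
  rw [eXM, eδ, eu, eXJ, eXU, et] at hMcMx
  rw [eYU, eδ, eYJ, eu] at hJUy
  rw [eYM, eδ, eYJ, et] at hJMy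
  rw [eYM, eδ, eu, eYJ, eYU, et] at hMcMy
  rw [eδ, eu, eYJ, eYU, eXM] at hMcM2
  rw [eδ, eu, eXJ, eXU, eYM] at hMcM2'
  rw [eXM, eu, eXU, et] at hBx
  rw [eYM, eu, eYU, et] at hBy
  rw [eu, eYU, eXM] at hBB2
  rw [eu, eXU, eYM] at hBB2'
  rw [et, eXM, eYM] at hMM
  rw [eδ, eu, et, eXJ, eXU, eXM, eYJ, eYU, eYM]
  exact cg_mminus_general a K0 K1 K2 K12 u0 U1 U2 U12 b b1 b2 XYM ha hK00 hK10 hK20 hK120 hu00 hU10 hU20 hU120 hb0 hb10 hb20 hXYM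
    (by linear_combination hBB2) (by linear_combination hBB2') (by linear_combination hBx) (by linear_combination hBy)
    (by linear_combination hJMx) (by linear_combination hJMy) (by linear_combination hJUx) (by linear_combination hJUy)
    (by linear_combination hMM) (by linear_combination hMcM2) (by linear_combination hMcM2') (by linear_combination hMcMx) (by linear_combination hMcMy)

end MGateAll

end Summit.Ventures.PercRepro2.Coin
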